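import Literature.Analysis.PDE.HeatFreeFlowAdmissible
import Literature.Analysis.PDE.SobolevEnergy
import HarnessLib

/-!
# A sup bound by Sobolev energies via the heat semigroup (topic `Analysis/PDE`)

Analytic layer of the programme to prove short-time existence for quasilinear strictly
parabolic systems on a closed manifold (hypothesis `hQL` of
`Literature.Geometry.Riemannian.ricciFlow_shortTime_existence_of_quasilinear`). The iteration
schemes of that programme control Sobolev energies `E_k` (`SobolevEnergy.lean`) and need
pointwise (sup-norm) control of finitely many derivatives from them — a Sobolev embedding with
an arbitrary but fixed loss of derivatives. We prove the elementary embedding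

* `enorm_le_sum_eLpNorm_iterate_laplacian`: for an admissible `f` (`IsHeatAdmissible`: smooth,
  all derivatives bounded and square integrable) on an `n`-dimensional inner product space,
  `‖f(x)‖ ≤ Σ_{j ≤ n+1} ‖Δʲ f‖₂` for every `x`;
* `enorm_sq_le_sobolevEnergy`: hence `‖f(x)‖² ≤ C(n) E_{2n+2}(f)`;
* `IsHeatAdmissible.of_hasCompactSupport`: compactly supported smooth functions are admissible.

The proof is by the heat semigroup `S(t) = e^{tΔ}` (all in the tree): the curve
`φⱼ(r) = S(r)(Δʲf)(x)` is differentiable on `[0, ∞)` (one-sided at `0`) with `φⱼ' = φⱼ₊₁`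
(`hasDerivWithinAt_freeFlow`), so the Taylor polynomial at `r` evaluated at `0`,
`T(r) = Σ_{j ≤ n} ((-r)ʲ/j!) φⱼ(r)`, telescopes: `T' (r) = ((-r)ⁿ/n!) φₙ₊₁(r)`, `T(0) = f(x)`.
Hence `f(x) = T(1) - ∫₀¹ ((-r)ⁿ/n!) S(r)(Δⁿ⁺¹f)(x) dr`, and the pointwise `L²` bound of the heat
semigroup `‖S(r)g(x)‖ ≤ (4πr)^{-n/4} ‖g‖₂` (`enorm_heatExtension_le`, Hölder) finishes, the
factor `rⁿ` absorbing the singularity `r^{-n/4}`.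

Everything is proved; no named fact and no `sorry` is introduced.

## References

* L. C. Evans, *Partial Differential Equations*, 2nd ed., AMS 2010, §5.6.3, Thm. 6 (general
  Sobolev inequalities: `H^k ⊂ C⁰` for `k > n/2`; here with the non-optimal order `2n + 2`) and
  §2.3.1 (the heat kernel). [Evans2010]
* Y. Giga, M.-H. Giga, J. Saal, *Nonlinear Partial Differential Equations*, Birkhäuser 2010,
  §1.1.3 (the `Lᵖ–L^∞` estimate of `e^{tΔ}`). [GigaGigaSaal2010]
-/

noncomputable section

open MeasureTheory Set Function Filter Topology TopologicalSpace Metric InnerProductSpace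
open scoped RealInnerProductSpace Laplacian ContDiff ENNReal Nat

namespace Literature.Analysis.PDE

open Literature.Analysis.UnboundedOperators Literature.Analysis.FluidPDE
  Literature.Analysis.FunctionSpaces

variable {E : Type*} [NormedAddCommGroup E] [InnerProductSpace ℝ E] [FiniteDimensional ℝ E]
  [MeasurableSpace E] [BorelSpace E]
variable {F' : Type*} [NormedAddCommGroup F'] [InnerProductSpace ℝ F'] [FiniteDimensional ℝ F']

/-! ### Compactly supported smooth functions are admissible -/

omit [FiniteDimensional ℝ F'] in
/-- A compactly supported smooth function is admissible for the free heat flow (all its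
iterated directional derivatives are continuous with compact support, hence bounded and in
`L²`). [folklore] -/
theorem IsHeatAdmissible.of_hasCompactSupport {f : E → F'} (hf : ContDiff ℝ ∞ f)
    (hc : HasCompactSupport f) : IsHeatAdmissible f where
  contDiff := hf
  bounded β := by
    have hcont : Continuous (iterDirDeriv β f) := (contDiff_iterDirDeriv hf β).continuous
    obtain ⟨C, hC⟩ := hcont.norm.bddAbove_range_of_hasCompactSupport
      (hasCompactSupport_iterDirDeriv hc β).norm
    exact ⟨C, fun x ↦ hC (Set.mem_range_self x)⟩
  memLp β := (contDiff_iterDirDeriv hf β).continuous.memLp_of_hasCompactSupport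
    (hasCompactSupport_iterDirDeriv hc β)

/-! ### Iterated Laplacians -/

omit [FiniteDimensional ℝ F'] in
/-- Iterated Laplacians of admissible data are admissible. [folklore] -/
theorem IsHeatAdmissible.iterate_laplacian {f : E → F'} (hf : IsHeatAdmissible f) :
    ∀ j : ℕ, IsHeatAdmissible ((fun g : E → F' ↦ Δ g)^[j] f)
  | 0 => hf
  | j + 1 => by
    rw [Function.iterate_succ_apply']
    exact (hf.iterate_laplacian j).laplacian

omit [MeasurableSpace E] [BorelSpace E] [FiniteDimensional ℝ F'] in
/-- The Laplacian of a smooth function is smooth. [folklore] -/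
theorem contDiff_laplacian_of_contDiff {g : E → F'} (hg : ContDiff ℝ ∞ g) : ContDiff ℝ ∞ (Δ g) := by
  rw [IsHeatAdmissible.laplacian_eq_sum hg]
  refine ContDiff.sum fun i _ ↦ ?_
  have h1 : ContDiff ℝ ∞ fun y ↦ fderiv ℝ g y (stdOrthonormalBasis ℝ E i) :=
    (hg.fderiv_right (m := ∞) (by norm_cast)).clm_apply contDiff_const
  exact (h1.fderiv_right (m := ∞) (by norm_cast)).clm_apply contDiff_const

omit [MeasurableSpace E] [BorelSpace E] [FiniteDimensional ℝ F'] in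
/-- Iterated Laplacians of smooth functions are smooth. [folklore] -/
theorem contDiff_iterate_laplacian {f : E → F'} (hf : ContDiff ℝ ∞ f) :
    ∀ j : ℕ, ContDiff ℝ ∞ ((fun g : E → F' ↦ Δ g)^[j] f)
  | 0 => hf
  | j + 1 => by
    rw [Function.iterate_succ_apply']
    exact contDiff_laplacian_of_contDiff (contDiff_iterate_laplacian hf j)

omit [FiniteDimensional ℝ F'] in
/-- **The Laplacian costs two orders of energy**: `E_k(Δg) ≤ 2ⁿ E_{k+2}(g)` for smooth `g`
(`Δg = Σᵢ ∂ᵢ∂ᵢg` and `E_k(∂ᵢ∂ᵢg) ≤ E_{k+1}(∂ᵢg)`, `Σᵢ E_{k+1}(∂ᵢg) ≤ E_{k+2}(g)`).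
[cite: Evans2010, §5.6.3] -/
theorem sobolevEnergy_laplacian_le (k : ℕ) {g : E → F'} (hg : ContDiff ℝ ∞ g) :
    sobolevEnergy k (Δ g) ≤ 2 ^ Module.finrank ℝ E * sobolevEnergy (k + 2) g := by
  rw [IsHeatAdmissible.laplacian_eq_sum hg]
  have hgi : ∀ i, ContDiff ℝ ∞ fun y ↦ fderiv ℝ g y (stdOrthonormalBasis ℝ E i) := fun i ↦
    (hg.fderiv_right (m := ∞) (by norm_cast)).clm_apply contDiff_const
  have hgii : ∀ i, ContDiff ℝ k fun x ↦ fderiv ℝ (fun y ↦ fderiv ℝ g y (stdOrthonormalBasis ℝ E i))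
      x (stdOrthonormalBasis ℝ E i) := fun i ↦
    (((hgi i).fderiv_right (m := ∞) (by norm_cast)).clm_apply contDiff_const).of_le
      (by exact_mod_cast le_top)
  refine (sobolevEnergy_sum_le k Finset.univ fun i _ ↦ hgii i).trans ?_
  rw [Finset.card_univ, Fintype.card_fin]
  refine mul_le_mul' le_rfl ?_
  -- `E_k(∂ᵢ∂ᵢg) ≤ E_{k+1}(∂ᵢg)` and `Σᵢ E_{k+1}(∂ᵢg) ≤ E_{k+2}(g)`
  refine le_trans (Finset.sum_le_sum fun i _ ↦ ?_) (sum_sobolevEnergy_fderiv_le (k + 1) g)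
  rw [sobolevEnergy_succ k]
  refine le_trans ?_ le_add_self
  exact Finset.single_le_sum (f := fun j ↦ sobolevEnergy k fun x ↦
    fderiv ℝ (fun y ↦ fderiv ℝ g y (stdOrthonormalBasis ℝ E i)) x (stdOrthonormalBasis ℝ E j))
    (fun j _ ↦ bot_le) (Finset.mem_univ i)

omit [FiniteDimensional ℝ F'] in
/-- Iterating: `E_k(Δʲ g) ≤ (2ⁿ)ʲ E_{k+2j}(g)` for smooth `g`. [cite: Evans2010, §5.6.3] -/
theorem sobolevEnergy_iterate_laplacian_le : ∀ (j k : ℕ) {g : E → F'}, ContDiff ℝ ∞ g →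
    sobolevEnergy k ((fun h : E → F' ↦ Δ h)^[j] g) ≤
      (2 ^ Module.finrank ℝ E) ^ j * sobolevEnergy (k + 2 * j) g
  | 0, k, g, _ => by simp
  | j + 1, k, g, hg => by
    rw [Function.iterate_succ_apply]
    refine (sobolevEnergy_iterate_laplacian_le j k (contDiff_laplacian_of_contDiff hg)).trans ?_
    refine (mul_le_mul' le_rfl (sobolevEnergy_laplacian_le (k + 2 * j) hg)).trans ?_
    rw [← mul_assoc, ← pow_succ, show k + 2 * j + 2 = k + 2 * (j + 1) by ring]

/-! ### The Taylor telescoping along the heat semigroup -/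

section Taylor

variable {f : E → F'}

omit [FiniteDimensional ℝ E] [MeasurableSpace E] [BorelSpace E] in
/-- The derivative of the Taylor weight `(-r)^{j+1}/(j+1)!` is `-(-r)ʲ/j!`. [folklore] -/
theorem hasDerivAt_negPow_div_factorial (j : ℕ) (r : ℝ) :
    HasDerivAt (fun s : ℝ ↦ (-s) ^ (j + 1) / ((j + 1) ! : ℝ)) (-((-r) ^ j / (j ! : ℝ))) r := by
  have h := ((hasDerivAt_neg' r).pow (j + 1)).div_const ((j + 1) ! : ℝ)
  simp only [Nat.add_sub_cancel] at h
  have heq : ((j + 1 : ℕ) : ℝ) * (-r) ^ j * -1 / ((j + 1) ! : ℝ) = -((-r) ^ j / (j ! : ℝ)) := by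
    rw [Nat.factorial_succ, Nat.cast_mul]
    have hj : ((j ! : ℕ) : ℝ) ≠ 0 := by exact_mod_cast (Nat.factorial_pos j).ne'
    have hj1 : ((j + 1 : ℕ) : ℝ) ≠ 0 := by exact_mod_cast Nat.succ_ne_zero j
    field_simp
  rw [heq] at h
  exact h

omit [FiniteDimensional ℝ E] [MeasurableSpace E] [BorelSpace E] in
/-- The Taylor weights are at most one in absolute value on `|r| ≤ 1`. [folklore] -/
theorem abs_negPow_div_factorial_le_one (j : ℕ) {r : ℝ} (hr : |r| ≤ 1) :
    |(-r) ^ j / (j ! : ℝ)| ≤ 1 := by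
  rw [abs_div, abs_pow, abs_neg, Nat.abs_cast]
  have h1 : |r| ^ j ≤ 1 := pow_le_one₀ (abs_nonneg r) hr
  have h2 : (1 : ℝ) ≤ (j ! : ℝ) := by exact_mod_cast Nat.one_le_iff_ne_zero.2 (Nat.factorial_ne_zero j)
  calc |r| ^ j / (j ! : ℝ) ≤ |r| ^ j / 1 := by
        exact div_le_div_of_nonneg_left (pow_nonneg (abs_nonneg r) j) one_pos h2
    _ ≤ 1 := by rw [div_one]; exact h1

/-- The curves `φⱼ(r) = e^{rΔ}(Δʲf)(x)` satisfy `φⱼ' = φⱼ₊₁` on `[0, ∞)` (the heat equation for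
the free flow, one-sided at `0`). [cite: Evans2010, §2.3.1, Thm. 1] -/
theorem hasDerivWithinAt_freeFlow_iterate_laplacian (hf : IsHeatAdmissible f) (x : E) (j : ℕ)
    {r : ℝ} (hr : 0 ≤ r) :
    HasDerivWithinAt (fun s ↦ freeFlow 1 ((fun g : E → F' ↦ Δ g)^[j] f) s x)
      (freeFlow 1 ((fun g : E → F' ↦ Δ g)^[j + 1] f) r x) (Ici 0) r := by
  have h := hasDerivWithinAt_freeFlow (hf.iterate_laplacian j) one_pos hr x
  rw [one_smul] at h
  have heq : freeFlow 1 (Δ ((fun g : E → F' ↦ Δ g)^[j] f)) r x =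
      freeFlow 1 ((fun g : E → F' ↦ Δ g)^[j + 1] f) r x := by
    rw [Function.iterate_succ_apply']
  rw [heq] at h
  exact h

/-- **Telescoping**: the Taylor polynomial at `r` evaluated at `0`,
`T_{m+1}(r) = Σ_{j ≤ m} ((-r)ʲ/j!) φⱼ(r)`, has derivative `((-r)ᵐ/m!) φₘ₊₁(r)` within `[0, ∞)`.
[folklore] -/
theorem hasDerivWithinAt_taylor_freeFlow (hf : IsHeatAdmissible f) (x : E) :
    ∀ (m : ℕ) {r : ℝ}, 0 ≤ r →
      HasDerivWithinAt (fun s ↦ ∑ j ∈ Finset.range (m + 1),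
          ((-s) ^ j / (j ! : ℝ)) • freeFlow 1 ((fun g : E → F' ↦ Δ g)^[j] f) s x)
        (((-r) ^ m / (m ! : ℝ)) • freeFlow 1 ((fun g : E → F' ↦ Δ g)^[m + 1] f) r x)
        (Ici 0) r
  | 0, r, hr => by
    have hT : (fun s ↦ ∑ j ∈ Finset.range (0 + 1),
        ((-s) ^ j / (j ! : ℝ)) • freeFlow 1 ((fun g : E → F' ↦ Δ g)^[j] f) s x) =
        fun s ↦ freeFlow 1 ((fun g : E → F' ↦ Δ g)^[0] f) s x := by
      funext s
      simp
    rw [hT, pow_zero, Nat.factorial_zero, Nat.cast_one, div_one, one_smul]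
    exact hasDerivWithinAt_freeFlow_iterate_laplacian hf x 0 hr
  | m + 1, r, hr => by
    set ph : ℕ → ℝ → F' := fun j s ↦ freeFlow 1 ((fun g : E → F' ↦ Δ g)^[j] f) s x with hph
    have hT : (fun s ↦ ∑ j ∈ Finset.range (m + 1 + 1), ((-s) ^ j / (j ! : ℝ)) • ph j s) =
        fun s ↦ (∑ j ∈ Finset.range (m + 1), ((-s) ^ j / (j ! : ℝ)) • ph j s) +
          ((-s) ^ (m + 1) / ((m + 1) ! : ℝ)) • ph (m + 1) s := by
      funext s
      rw [Finset.sum_range_succ]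
    rw [hT]
    have h1 := hasDerivWithinAt_taylor_freeFlow hf x m hr
    have h2 := ((hasDerivAt_negPow_div_factorial m r).hasDerivWithinAt (s := Ici 0)).smul
      (hasDerivWithinAt_freeFlow_iterate_laplacian hf x (m + 1) hr)
    have h := h1.add h2
    have hval : ((-r) ^ m / (m ! : ℝ)) • ph (m + 1) r +
        (((-r) ^ (m + 1) / ((m + 1) ! : ℝ)) • ph (m + 1 + 1) r +
          (-((-r) ^ m / (m ! : ℝ))) • ph (m + 1) r) =
        ((-r) ^ (m + 1) / ((m + 1) ! : ℝ)) • ph (m + 2) r := by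
      rw [neg_smul]
      abel
    rw [hval] at h
    exact h

omit [FiniteDimensional ℝ F'] in
/-- `T_{m+1}(0) = f(x)`. [folklore] -/
theorem taylor_freeFlow_zero (f : E → F') (x : E) (m : ℕ) :
    ∑ j ∈ Finset.range (m + 1), ((-(0 : ℝ)) ^ j / (j ! : ℝ)) •
      freeFlow 1 ((fun g : E → F' ↦ Δ g)^[j] f) 0 x = f x := by
  rw [Finset.sum_eq_single 0]
  · simp
  · intro j _ hj
    rw [neg_zero, zero_pow hj, zero_div, zero_smul]
  · intro h
    exact absurd (Finset.mem_range.2 (Nat.succ_pos m)) h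

/-- **Taylor's formula with integral remainder along the heat flow**:
`f(x) = Σ_{j ≤ m} ((-1)ʲ/j!) e^{Δ}(Δʲf)(x) - ∫₀¹ ((-r)ᵐ/m!) e^{rΔ}(Δᵐ⁺¹f)(x) dr`. [folklore] -/
theorem taylor_freeFlow_identity (hf : IsHeatAdmissible f) (x : E) (m : ℕ) :
    f x = (∑ j ∈ Finset.range (m + 1), ((-(1 : ℝ)) ^ j / (j ! : ℝ)) •
        freeFlow 1 ((fun g : E → F' ↦ Δ g)^[j] f) 1 x) -
      ∫ r in (0 : ℝ)..1, ((-r) ^ m / (m ! : ℝ)) •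
        freeFlow 1 ((fun g : E → F' ↦ Δ g)^[m + 1] f) r x := by
  set T : ℝ → F' := fun s ↦ ∑ j ∈ Finset.range (m + 1),
    ((-s) ^ j / (j ! : ℝ)) • freeFlow 1 ((fun g : E → F' ↦ Δ g)^[j] f) s x with hT
  have hcont : ContinuousOn T (Icc 0 1) := fun r hr ↦
    ((hasDerivWithinAt_taylor_freeFlow hf x m hr.1).continuousWithinAt).mono Icc_subset_Ici_self
  have hderiv : ∀ r ∈ Ioo (0 : ℝ) 1, HasDerivAt T
      (((-r) ^ m / (m ! : ℝ)) • freeFlow 1 ((fun g : E → F' ↦ Δ g)^[m + 1] f) r x) r :=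
    fun r hr ↦ (hasDerivWithinAt_taylor_freeFlow hf x m hr.1.le).hasDerivAt (Ici_mem_nhds hr.1)
  have hint : IntervalIntegrable (fun r ↦ ((-r) ^ m / (m ! : ℝ)) •
      freeFlow 1 ((fun g : E → F' ↦ Δ g)^[m + 1] f) r x) volume 0 1 := by
    refine ContinuousOn.intervalIntegrable ?_
    rw [uIcc_of_le zero_le_one]
    have hc : Continuous fun r : ℝ ↦ (-r) ^ m / (m ! : ℝ) := by fun_prop
    have hφ : ContinuousOn (fun s ↦ freeFlow 1 ((fun g : E → F' ↦ Δ g)^[m + 1] f) s x) (Ici 0) :=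
      fun s hs ↦ (hasDerivWithinAt_freeFlow_iterate_laplacian hf x (m + 1) hs).continuousWithinAt
    exact hc.continuousOn.smul (hφ.mono Icc_subset_Ici_self)
  have h := intervalIntegral.integral_eq_sub_of_hasDerivAt_of_le zero_le_one hcont hderiv hint
  rw [h, hT]
  simp only
  rw [taylor_freeFlow_zero]
  abel

end Taylor

/-! ### The pointwise bound of the heat semigroup and the embedding -/

omit [FiniteDimensional ℝ E] [MeasurableSpace E] [BorelSpace E] in
/-- The `L²–L^∞` factor of the heat semigroup is at most one at time `1`:
`((4π)^{-n/2})^{1/2} ≤ 1`. [folklore] -/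
theorem heatFactor_one_le_one :
    ENNReal.ofReal ((4 * Real.pi * 1) ^ (-(Module.finrank ℝ E : ℝ) / 2)) ^ (2 : ℝ≥0∞)⁻¹.toReal ≤ 1 := by
  refine ENNReal.rpow_le_one ?_ ENNReal.toReal_nonneg
  refine ENNReal.ofReal_le_one.2 ?_
  rw [mul_one]
  refine Real.rpow_le_one_of_one_le_of_nonpos ?_ ?_
  · have := Real.pi_gt_three
    linarith
  · have : (0 : ℝ) ≤ (Module.finrank ℝ E : ℝ) := by positivity
    rw [neg_div]
    exact neg_nonpos.2 (by positivity)

omit [FiniteDimensional ℝ E] [MeasurableSpace E] [BorelSpace E] in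
/-- The remainder weight absorbs the heat-kernel singularity:
`(rⁿ/n!) · ((4πr)^{-n/2})^{1/2} ≤ 1` for `0 < r ≤ 1` (`n = dim E`). [folklore] -/
theorem remainder_weight_le_one {r : ℝ} (hr : 0 < r) (hr1 : r ≤ 1) :
    ENNReal.ofReal (r ^ Module.finrank ℝ E / ((Module.finrank ℝ E) ! : ℝ)) *
      ENNReal.ofReal ((4 * Real.pi * r) ^ (-(Module.finrank ℝ E : ℝ) / 2)) ^ (2 : ℝ≥0∞)⁻¹.toReal ≤ 1 := by
  set n := Module.finrank ℝ E with hn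
  have hpi : (0 : ℝ) < 4 * Real.pi * r := by positivity
  have htwo : (2 : ℝ≥0∞)⁻¹.toReal = 2⁻¹ := by
    rw [ENNReal.toReal_inv]; norm_num
  rw [htwo, ENNReal.ofReal_rpow_of_nonneg (Real.rpow_nonneg hpi.le _) (by norm_num),
    ← ENNReal.ofReal_mul (by positivity)]
  refine ENNReal.ofReal_le_one.2 ?_
  -- real arithmetic: `((4πr)^{-n/2})^{1/2} = (4π)^{-n/4} r^{-n/4} ≤ r^{-n/4}`, `rⁿ r^{-n/4} ≤ 1`
  have h1 : ((4 * Real.pi * r) ^ (-(n : ℝ) / 2)) ^ (2⁻¹ : ℝ) = (4 * Real.pi) ^ (-(n : ℝ) / 4) * r ^ (-(n : ℝ) / 4) := by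
    rw [← Real.rpow_mul hpi.le, Real.mul_rpow (by positivity) hr.le]
    congr 1 <;> ring_nf
  have h2 : (4 * Real.pi : ℝ) ^ (-(n : ℝ) / 4) ≤ 1 := by
    refine Real.rpow_le_one_of_one_le_of_nonpos ?_ ?_
    · have := Real.pi_gt_three; linarith
    · rw [neg_div]
      exact neg_nonpos.2 (by positivity)
  have h3 : r ^ n * r ^ (-(n : ℝ) / 4) ≤ 1 := by
    rw [← Real.rpow_natCast, ← Real.rpow_add hr]
    exact Real.rpow_le_one hr.le hr1 (by
      have : (0 : ℝ) ≤ (n : ℝ) := by positivity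
      linarith)
  have hfact : (1 : ℝ) ≤ (n ! : ℝ) := by exact_mod_cast Nat.one_le_iff_ne_zero.2 (Nat.factorial_ne_zero n)
  have h4 : r ^ n / (n ! : ℝ) ≤ r ^ n := div_le_self (pow_nonneg hr.le n) hfact
  rw [h1]
  calc r ^ n / (n ! : ℝ) * ((4 * Real.pi) ^ (-(n : ℝ) / 4) * r ^ (-(n : ℝ) / 4))
      ≤ r ^ n * (1 * r ^ (-(n : ℝ) / 4)) := by
        refine mul_le_mul h4 (mul_le_mul_of_nonneg_right h2 (Real.rpow_nonneg hr.le _))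
          (by positivity) (pow_nonneg hr.le n)
    _ = r ^ n * r ^ (-(n : ℝ) / 4) := by rw [one_mul]
    _ ≤ 1 := h3

/-- **Sup bound by iterated Laplacians in `L²`**: for admissible `f` on an `n`-dimensional
inner product space and every `x`,
`‖f(x)‖ ≤ Σ_{j ≤ n+1} ‖Δʲ f‖_{L²}`. [cite: Evans2010, §5.6.3, Thm. 6] -/
theorem enorm_le_sum_eLpNorm_iterate_laplacian {f : E → F'} (hf : IsHeatAdmissible f) (x : E) :
    ‖f x‖ₑ ≤ ∑ j ∈ Finset.range (Module.finrank ℝ E + 2),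
      eLpNorm ((fun g : E → F' ↦ Δ g)^[j] f) 2 volume := by
  set n := Module.finrank ℝ E with hn
  set N : ℕ → ℝ≥0∞ := fun j ↦ eLpNorm ((fun g : E → F' ↦ Δ g)^[j] f) 2 volume with hN
  set ph : ℕ → ℝ → F' := fun j s ↦ freeFlow 1 ((fun g : E → F' ↦ Δ g)^[j] f) s x with hph
  set cw : ℕ → ℝ → ℝ := fun j s ↦ (-s) ^ j / (j ! : ℝ) with hcw
  -- the pointwise heat bound at `r ∈ (0, 1]`
  have hheat : ∀ j {r : ℝ}, 0 < r → ‖ph j r‖ₑ ≤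
      ENNReal.ofReal ((4 * Real.pi * r) ^ (-(n : ℝ) / 2)) ^ (2 : ℝ≥0∞)⁻¹.toReal * N j := by
    intro j r hr
    rw [hph]
    simp only
    rw [freeFlow_of_pos 1 _ hr, one_mul]
    exact enorm_heatExtension_le (hf.iterate_laplacian j).memLp_two one_le_two hr x
  -- the Taylor identity with `m = n`
  have hid : f x = (∑ j ∈ Finset.range (n + 1), cw j 1 • ph j 1) -
      ∫ r in (0 : ℝ)..1, cw n r • ph (n + 1) r := taylor_freeFlow_identity hf x n
  -- bound of `T_{n+1}(1)`
  have hT1 : ‖∑ j ∈ Finset.range (n + 1), cw j 1 • ph j 1‖ₑ ≤ ∑ j ∈ Finset.range (n + 1), N j := by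
    refine (enorm_sum_le _ _).trans (Finset.sum_le_sum fun j _ ↦ ?_)
    rw [enorm_smul]
    have hc1 : ‖cw j 1‖ₑ ≤ 1 := by
      rw [Real.enorm_eq_ofReal_abs]
      exact ENNReal.ofReal_le_one.2 (abs_negPow_div_factorial_le_one j (by simp))
    calc ‖cw j 1‖ₑ * ‖ph j 1‖ₑ ≤ 1 * (ENNReal.ofReal ((4 * Real.pi * 1) ^ (-(n : ℝ) / 2)) ^
          (2 : ℝ≥0∞)⁻¹.toReal * N j) := mul_le_mul' hc1 (hheat j one_pos)
      _ ≤ 1 * (1 * N j) := by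
          refine mul_le_mul' le_rfl (mul_le_mul' ?_ le_rfl)
          exact heatFactor_one_le_one
      _ = N j := by rw [one_mul, one_mul]
  -- bound of the remainder integral
  have hR : ‖∫ r in (0 : ℝ)..1, cw n r • ph (n + 1) r‖ₑ ≤ N (n + 1) := by
    rw [intervalIntegral.integral_of_le zero_le_one]
    refine (enorm_integral_le_lintegral_enorm _).trans ?_
    have hbound : ∀ r ∈ Ioc (0 : ℝ) 1, ‖cw n r • ph (n + 1) r‖ₑ ≤ N (n + 1) := by
      intro r hr
      rw [enorm_smul]
      have hc' : ‖cw n r‖ₑ ≤ ENNReal.ofReal (r ^ n / (n ! : ℝ)) := by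
        rw [Real.enorm_eq_ofReal_abs]
        refine ENNReal.ofReal_le_ofReal (le_of_eq ?_)
        rw [hcw]
        simp only
        rw [abs_div, abs_pow, abs_neg, abs_of_pos hr.1, Nat.abs_cast]
      calc ‖cw n r‖ₑ * ‖ph (n + 1) r‖ₑ
          ≤ ENNReal.ofReal (r ^ n / (n ! : ℝ)) * (ENNReal.ofReal ((4 * Real.pi * r) ^ (-(n : ℝ) / 2)) ^
              (2 : ℝ≥0∞)⁻¹.toReal * N (n + 1)) := mul_le_mul' hc' (hheat (n + 1) hr.1)
        _ = (ENNReal.ofReal (r ^ n / (n ! : ℝ)) * ENNReal.ofReal ((4 * Real.pi * r) ^ (-(n : ℝ) / 2)) ^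
              (2 : ℝ≥0∞)⁻¹.toReal) * N (n + 1) := (mul_assoc _ _ _).symm
        _ ≤ 1 * N (n + 1) := mul_le_mul' (remainder_weight_le_one hr.1 hr.2) le_rfl
        _ = N (n + 1) := one_mul _
    calc ∫⁻ r in Ioc (0 : ℝ) 1, ‖cw n r • ph (n + 1) r‖ₑ
        ≤ ∫⁻ _ in Ioc (0 : ℝ) 1, N (n + 1) :=
          lintegral_mono_ae ((ae_restrict_iff' measurableSet_Ioc).2 (ae_of_all _ hbound))
      _ = N (n + 1) := by
          rw [setLIntegral_const, Real.volume_Ioc, sub_zero, ENNReal.ofReal_one, mul_one]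
  -- assemble
  calc ‖f x‖ₑ = ‖(∑ j ∈ Finset.range (n + 1), cw j 1 • ph j 1) -
        ∫ r in (0 : ℝ)..1, cw n r • ph (n + 1) r‖ₑ := by rw [← hid]
    _ ≤ ‖∑ j ∈ Finset.range (n + 1), cw j 1 • ph j 1‖ₑ +
        ‖∫ r in (0 : ℝ)..1, cw n r • ph (n + 1) r‖ₑ := enorm_sub_le
    _ ≤ (∑ j ∈ Finset.range (n + 1), N j) + N (n + 1) := add_le_add hT1 hR
    _ = ∑ j ∈ Finset.range (n + 2), N j := by rw [Finset.sum_range_succ _ (n + 1)]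

omit [InnerProductSpace ℝ F'] [FiniteDimensional ℝ F'] in
/-- `‖g‖_{L²}² = ∫ ‖g‖ₑ²`: the `μ = volume` case of
`Literature.Analysis.FluidPDE.MollifiedLimits.eLpNorm_two_pow_two` (`MollifiedLimits.lean`), kept
under its old name as a deprecated alias (dedup-00673); use `MollifiedLimits.eLpNorm_two_pow_two`.
[folklore] -/
@[deprecated MollifiedLimits.eLpNorm_two_pow_two (since := "2026-08-15")]
theorem eLpNorm_two_sq_eq_lintegral [NormedSpace ℝ F'] (g : E → F') :
    eLpNorm g 2 volume ^ 2 = ∫⁻ x, ‖g x‖ₑ ^ 2 :=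
  MollifiedLimits.eLpNorm_two_pow_two g

/-- **Sup bound by the Sobolev energy** (the embedding `H^{2n+2} ⊂ L^∞` with an explicit,
non-optimal loss): there is `C < ∞` depending only on `E` such that
`‖f(x)‖² ≤ C · E_{2n+2}(f)` for every admissible `f` and every `x`.
[cite: Evans2010, §5.6.3, Thm. 6] -/
theorem enorm_sq_le_sobolevEnergy :
    ∃ C : ℝ≥0∞, C ≠ ⊤ ∧ ∀ {f : E → F'}, IsHeatAdmissible f → ∀ x,
      ‖f x‖ₑ ^ 2 ≤ C * sobolevEnergy (2 * (Module.finrank ℝ E + 1)) f := by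
  set n := Module.finrank ℝ E with hn
  set a : ℝ≥0∞ := (2 ^ n) ^ (n + 1) with ha
  refine ⟨((n + 2 : ℕ) : ℝ≥0∞) ^ 2 * a, ?_, ?_⟩
  · exact ENNReal.mul_ne_top (ENNReal.pow_ne_top (ENNReal.natCast_ne_top _))
      (ENNReal.pow_ne_top (ENNReal.pow_ne_top (by simp)))
  intro f hf x
  set B := a * sobolevEnergy (2 * (n + 1)) f with hB
  -- each `‖Δʲ f‖₂² ≤ B` for `j ≤ n + 1`
  have hNj : ∀ j ∈ Finset.range (n + 2),
      eLpNorm ((fun g : E → F' ↦ Δ g)^[j] f) 2 volume ≤ B ^ (2⁻¹ : ℝ) := by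
    intro j hj
    have hj' : j ≤ n + 1 := Nat.lt_succ_iff.1 (Finset.mem_range.1 hj)
    have hsq : eLpNorm ((fun g : E → F' ↦ Δ g)^[j] f) 2 volume ^ 2 ≤ B := by
      rw [MollifiedLimits.eLpNorm_two_pow_two, ← sobolevEnergy_zero_left]
      refine (sobolevEnergy_iterate_laplacian_le j 0 hf.contDiff).trans ?_
      rw [zero_add]
      refine mul_le_mul' ?_ (sobolevEnergy_mono (by omega) f)
      rw [ha]
      exact pow_le_pow_right₀ (one_le_pow_of_one_le' one_le_two _) hj'
    calc eLpNorm ((fun g : E → F' ↦ Δ g)^[j] f) 2 volume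
        = (eLpNorm ((fun g : E → F' ↦ Δ g)^[j] f) 2 volume ^ 2) ^ (2⁻¹ : ℝ) := by
          rw [show (2⁻¹ : ℝ) = ((2 : ℕ) : ℝ)⁻¹ by norm_num, ENNReal.pow_rpow_inv_natCast two_ne_zero]
      _ ≤ B ^ (2⁻¹ : ℝ) := ENNReal.rpow_le_rpow hsq (by norm_num)
  have h1 : ‖f x‖ₑ ≤ ((n + 2 : ℕ) : ℝ≥0∞) * B ^ (2⁻¹ : ℝ) := by
    refine (enorm_le_sum_eLpNorm_iterate_laplacian hf x).trans ?_
    refine (Finset.sum_le_sum hNj).trans ?_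
    rw [Finset.sum_const, Finset.card_range, nsmul_eq_mul]
  calc ‖f x‖ₑ ^ 2 ≤ (((n + 2 : ℕ) : ℝ≥0∞) * B ^ (2⁻¹ : ℝ)) ^ 2 := pow_le_pow_left' h1 2
    _ = ((n + 2 : ℕ) : ℝ≥0∞) ^ 2 * B := by
        rw [mul_pow, show (2⁻¹ : ℝ) = ((2 : ℕ) : ℝ)⁻¹ by norm_num,
          ENNReal.rpow_inv_natCast_pow two_ne_zero]
    _ = ((n + 2 : ℕ) : ℝ≥0∞) ^ 2 * a * sobolevEnergy (2 * (n + 1)) f := by rw [hB, mul_assoc]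

end Literature.Analysis.PDE

end
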